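import Summits.Ventures.AbcSig.Rows.XTemplateC2a
import Summits.Ventures.AbcSig.Levels.N122
import Summits.Ventures.AbcSig.Levels.N1952
import Summits.Ventures.AbcSig.Levels.N122M6X

/-!
# Venture AbcSig — ROW `C2aL61A0`: `xⁿ + 2^a·61^m·yⁿ = z²`, class `a 0` (GENERATED by plean/leanrow.py)

HONEST FRAMING. A row of a COMPUTATION cell (`pub-abcsig`); a CONDITIONAL theorem, no claim on ABC or any summit.
Hypotheses: `BS04Package` (CITED), `DataComplete` at levels [122, 1952] (COMPUTED, two-engine certified
level files), `EisPackage` (CITED: [BS04 (3.1), L4.2, Cor 3.1] + [Sturm 1987]) and `Refines` (COMPUTED) for the orbits whose residual exponent is discharged IN THE KERNEL by a module-M6 certificate (`Levels/N…M6X.lean`), and the listed per-orbit exclusions `hX_…` (CITED; the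
row's R5 cell names each) that remain. Everything else is kernel-checked (`Rows/XTemplateC2a.lean`, `Levels/N….lean`). Exponent
range: prime `n ≥ 11`, `n ≠ 61`, n ∉ [13]; `B = 2^a 61^m` with `a, m < n` (n-th-power free).
Row of record:  (sha256 ; SIGNED 2026-08-22T08:50:29Z by referee (ref-g4)); its R0: THEOREM for primes n >= 11, n not in [13] (uses CITED facts); the survivors [13] need M4 (Kraus) / stay open — class: R-b ARGUMENT-SUPPLIED (printed claim true;. Exponents left open by the row of record are excluded here via ; kernel-sieve residuals the row of record closes by a cell module (M6 Eisenstein / M4 Kraus certificates) appear as CITED hypotheses .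
-/

namespace Summit.Ventures.AbcSig

/-- Row `C2aL61A0` (see module docstring). -/
theorem xrow_C2aL61A0 (M : NewformModel) (hP : M.BS04Package) (hE : M.EisPackage)
    (hD122 : M.DataComplete 122 level122Orbits) (hD1952 : M.DataComplete 1952 level1952Orbits)
    (hR_orbit_122_3 : M.Refines 122 orbit_122_3 m6X_122_3)
    (n : ℕ) (hn : n.Prime) (hmin : 11 ≤ n) (hnℓ : n ≠ 61) (hres : n ∉ ([13] : List ℕ)) (m : ℕ) (hm : 1 ≤ m) (hmn : m < n)
    
    (x y z : ℤ) (hxy1 : x * y ≠ 1) (hxy2 : x * y ≠ -1) : ¬ IsPrimitiveSolution 1 (2 ^ 0 * 61 ^ m) 1 n x y z := by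
  have hℓ : Nat.Prime 61 := by norm_num
  have h7 : 7 ≤ n := by omega
  have hS122 :=
    (level122_sieve n hn h7 (fun o => M.Excludes 122 o (famB (2 ^ 0 * 61 ^ m) n (fun _ _ => True)) ∨ M.ExcludesStd 122 o n) (fun hmem => by
      obtain rfl : n = 7 := by simpa using hmem
      omega) (fun hmem => by
      obtain rfl : n = 31 := by simpa using hmem
      exact Or.inr (m6c_122_3_n31_excludes M hE hR_orbit_122_3)))
  have hS1952 :=
    (level1952_sieve n hn h7 (fun o => M.Excludes 1952 o (famB (2 ^ 0 * 61 ^ m) n (fun _ _ => True)) ∨ M.ExcludesStd 1952 o n) (fun hmem => by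
      obtain rfl : n = 7 := by simpa using hmem
      omega) (fun hmem => by
      obtain rfl : n = 7 := by simpa using hmem
      omega) (fun hmem => by
      obtain rfl : n = 7 := by simpa using hmem
      omega) (fun hmem => by
      obtain rfl : n = 7 := by simpa using hmem
      omega) (fun hmem => by
      obtain rfl : n = 7 := by simpa using hmem
      omega) (fun hmem => by
      obtain rfl : n = 7 := by simpa using hmem
      omega) (fun hmem => by
      obtain rfl : n = 7 := by simpa using hmem
      omega) (fun hmem => by
      obtain rfl : n = 7 := by simpa using hmem
      omega) (fun hmem => by
      obtain rfl : n = 7 := by simpa using hmem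
      omega) (fun hmem => by
      obtain rfl : n = 7 := by simpa using hmem
      omega) (fun hmem => by
      obtain rfl : n = 13 := by simpa using hmem
      exact absurd (by simp) hres))
  exact xrowC2a_a0 61 hℓ (by norm_num) M hP n hn h7 hnℓ hD1952 hD122 m hm hmn
    hS1952
    hS122 x y z hxy1 hxy2

end Summit.Ventures.AbcSig
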